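/-
Copyright (c) 2026 the pub-hodgecm-mathlib formalisation cell (harness21).  Prover seat hodgecm-mathlib-F0P3a-p07 (g15) ((Cnt2′) chair): road «S3-ram» (LEAD F0P3a-plan (g13);
owner F0P3a-p06; fold pen F0P3-p02 (g17)); the (T2) G-SIDE ORGAN (Cnt2′), ODD discriminant parity — THE LANDED HEAD; 2026-09-02.
-/
import Literature.NumberTheory.Rogawski1990.DepthZeroKappaTransferTypeTwoRamifiedSignedCountsOfLatticeOdd     -- ★ p848483∕p848503 (this lineage, g14): H-FORM HEAD `typeTwo_signedCounts_odd_ram_of_latticeCounts (hZ hP)`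
import Literature.NumberTheory.Rogawski1990.DepthZeroKappaTransferTypeTwoRamifiedIntrinsicOfBlockLawZero       -- ★ p848712 (F0P3a-p03 (g18)): `stub_T2G_zero_odd_lat_of_blockLaw` (lattice ⟸ block law, WITH the spectral tie)
import Literature.NumberTheory.Rogawski1990.DepthZeroKappaTransferTypeTwoRamifiedIntrinsicOfBlockLawPm         -- ★ p848727 (F0P3a-p03 (g18)): `stub_T2G_pm_odd_lat_of_blockLaw`
-- KEEPER IMPORT PLACEHOLDER: import Literature.NumberTheory.Rogawski1990.DepthZeroKappaTransferTypeTwoRamifiedBlockLaw…   -- (α) keeper F0P3a-p06 (g16): `<keeper zero head>`, `<keeper pm head>`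
import Literature.NumberTheory.Rogawski1990.DepthZeroKappaTransferTypeTwoRamifiedBlockLawZeroOdd   -- ★ keeper F0P3a-p06 (g16): `TypeTwoBlockLaw.typeTwo_blockLaw_zero_odd_ram`
import Literature.NumberTheory.Rogawski1990.DepthZeroKappaTransferTypeTwoRamifiedBlockLawPmOdd   -- ★ keeper F0P3a-p06 (g16): `TypeTwoBlockLaw.typeTwo_blockLaw_pm_odd_ram`
import HarnessLib

/-!
# The depth-zero κ-transfer at a tame-ramified place, TYPE (2): THE FIVE SIGNED STRATA COUNT LAWS, ODD DISCRIMINANT DEPTH — the fold socket `stub_typeTwo_counts_odd_ram`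
# (Rogawski 1990 §4.9 Prop. 4.9.1; Labesse–Langlands 1979 §2; Kottwitz 1986 §3)

Topic `NumberTheory/Rogawski1990`; namespace `Literature.NumberTheory.Rogawski1990`.  THEOREMS ONLY (no definition, no instance, no notation, no named fact, no `sorry` at landing);
kernel lane `--supports stmt-HodgeConjecture-24833`.  Cell `pub/hodgecm-mathlib` (D-0151), crux H413; road «S3-ram» (count-neutral).  THIS IS THE (Cnt2′) CHAIR'S LANDING FILE:
**`typeTwo_signedCounts_odd_ram`** = the fold v7.11 socket `stub_typeTwo_counts_odd_ram` (F0P3-p02 (g17), `:889`) VERBATIM (statement bytes = chair skeleton v4.3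
238ac497fe775815), proved in ONE TERM by the CLOSING RECIPE (chair 2026-09-02T03:40Z): ★ H-form head `typeTwo_signedCounts_odd_ram_of_latticeCounts (hZ) (hP)` (★ p848483∕p848503)
fed with `hZ := stub_T2G_zero_odd_lat_of_blockLaw <15> (<keeper zero head> <15>)` and `hP := stub_T2G_pm_odd_lat_of_blockLaw <15> (<keeper pm head> <15>)` (★ p848712∕p848727, F0P3a-p03 (g18);
block-law heads = the (α) BLOCK-LAW SKELETON of keeper F0P3a-p06 (g16), cells by A-p16 (g33), F0P3a-p08 (g21), A-p19 (g29), F0P3a-p01 (g18), F0P3-p01 (g19), A-p12 (g25), F0P3a-p05 (g18), F0P3-p03 (g16),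
F0P2-p01 (g17), F0P3a-p04 (g20), F0P3a-p02 (g18), F0P3a-p03 (g18), B-p14 (g40) and the chair's dictionary ★ p849132∕p849164∕p849187∕p849319∕p849372).
BLOCK-LAW HEADS consumed by name: ★ `TypeTwoBlockLaw.typeTwo_blockLaw_zero_odd_ram` (p849773) and ★ `TypeTwoBlockLaw.typeTwo_blockLaw_pm_odd_ram` (p850016) (keeper F0P3a-p06 (g16), the (α) block-law skeleton closed over 16 cells by the (Cnt2′) pens).
HONEST LABEL: HC_CM is proved only modulo the 2 remaining named inputs (hLiu418 24832, h413 24833) until rung 0 closes; this file moves no count (Literature seeding, «S3-ram»).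

## References
* [Rogawski1990] J. D. Rogawski, *Automorphic Representations of Unitary Groups in Three Variables*, Ann. of Math. Stud. 123 (1990), §4.9 Prop. 4.9.1 pp. 54–56, Lemma 4.9.3.
* [LabesseLanglands1979] J.-P. Labesse, R. P. Langlands, *L-indistinguishability for SL(2)*, Canad. J. Math. 31 (1979), §2.
* [Kottwitz1986] R. E. Kottwitz, *Base change for unit elements of Hecke algebras*, Compositio Math. 60 (1986), §3.
-/

set_option autoImplicit false

noncomputable section

open MeasureTheory Measure Set Filter Topology NumberField IsDedekindDomain Matrix Polynomial ValuativeRel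
open Literature.NumberTheory.Automorphic Literature.NumberTheory.Automorphic.UnitaryGroup
open Literature.NumberTheory.Automorphic.IntegralReduction Literature.NumberTheory.GaloisRepresentations
open Literature.NumberTheory.NumberFields Literature.NumberTheory.QuadraticForms
open Literature.GroupTheory.SpecificGroups Literature.NumberTheory.Automorphic.UnitaryLatticeTree
open scoped Matrix MatrixGroups ValuativeRel

namespace Literature.NumberTheory.Rogawski1990

set_option maxHeartbeats 800000 in
set_option maxHeartbeats 1600000 in
-- budget only: statement-heavy socket text.
/-- **THE FIVE SIGNED STRATA COUNT LAWS OF THE TYPE-(2) G-SIDE, ODD DISCRIMINANT DEPTH** — the fold socket `stub_typeTwo_counts_odd_ram` VERBATIM: for every framed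
model `(e, heA, hK)`, every 2-deep `G`-regular rootless `γ_H` of discriminant depth `N = 2n+1` (`n ≥ 1`) with depth token `m`, symmetrised discriminant `β`, and every
matched pair `t₊, t₋` on the explicit tube with `κ = ±1`: the five signed differences of strata counts (bd, reg, 1⁺, 1⁻, 0) equal `±(β,θ)_v·q^m·X̃_j(n)` keyed by the favourable class.
ONE TERM: ★ `typeTwo_signedCounts_odd_ram_of_latticeCounts` ∘ ★ `stub_T2G_{zero,pm}_odd_lat_of_blockLaw` ∘ the block-law heads. [cite: Rogawski1990, §4.9 Prop. 4.9.1 pp. 54–56]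
[cite: LabesseLanglands1979, §2] [cite: Kottwitz1986, §3] -/
theorem typeTwo_signedCounts_odd_ram
    (L : Type) [Field L] [NumberField L] [IsCMField L] (H' : Matrix (Fin 3) (Fin 3) L)
    {v : HeightOneSpectrum (𝓞 ↥(maximalRealSubfield L))}
    (hH' : (H'.map (cmConjRingHom L)).transpose = H') (w : PlacesOver L v)
    (hw : IsCMField.complexConj L • w.1 = w.1) (he : v.asIdeal.ramificationIdx' w.1.asIdeal ≠ 1)
    (hH'w : IsUnit (placeForm H' w.1)) (hH'i : hH'w.unit ∈ glInt 3 (w.1.adicCompletion L))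
    (h2 : IsUnit (2 : 𝒪[(w.1.adicCompletion L)]))
    (ϖ : w.1.adicCompletion L) (hϖ : Valued.v ϖ = WithZero.exp (-1 : ℤ)) (hσϖ : galAdicCompletionMap (L := L) (IsCMField.complexConj L) hw ϖ = -ϖ)
    (A : GL (Fin 3) (w.1.adicCompletion L)) (hA : A ∈ glInt 3 (w.1.adicCompletion L))
    (hframe : placeForm H' w.1 = (-(placeForm H' w.1).det) • formCongr (galAdicCompletionMap (L := L) (IsCMField.complexConj L) hw) A ((StdForm.antidiagonal 3).over (w.1.adicCompletion L)))
    (yl : v.adicCompletion ↥(maximalRealSubfield L)) (hyl : toPlace v w yl = -(placeForm H' w.1).det) :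
    ∀ ⦃γH : ((cmDatum L 2 (Matrix.of fun i j : Fin 2 => if i.val + j.val + 1 = 2 then (1 : L) else 0)).Local v × (cmDatum L 1 (Matrix.of fun i j : Fin 1 => if i.val + j.val + 1 = 1 then (1 : L) else 0)).Local v)⦄,
      (∀ i j : Fin 2, Valued.v (((((γH.1.val : GL (Fin 2) (UnitaryGroup.LocalRing L v)).val.map (Pi.evalRingHom (fun w' : PlacesOver L v => w'.1.adicCompletion L) w))) - 1) i j) ≤ Valued.v (ϖ ^ 2)) → Valued.v (finGammaTwo L v γH w - 1) ≤ Valued.v (ϖ ^ 2) → IsLocalGRegular L v γH →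
      (¬ ∃ x : (w.1.adicCompletion L), ((((γH.1.val : GL (Fin 2) (UnitaryGroup.LocalRing L v)).val.map (Pi.evalRingHom (fun w' : PlacesOver L v => w'.1.adicCompletion L) w))).charpoly).IsRoot x) → ∀ ⦃n : ℕ⦄,
      Valued.v ((((γH.1.val : GL (Fin 2) (UnitaryGroup.LocalRing L v)).val.map (Pi.evalRingHom (fun w' : PlacesOver L v => w'.1.adicCompletion L) w))).trace ^ 2 - 4 * (((γH.1.val : GL (Fin 2) (UnitaryGroup.LocalRing L v)).val.map (Pi.evalRingHom (fun w' : PlacesOver L v => w'.1.adicCompletion L) w))).det) = WithZero.exp (-((2 * (2 * n + 1) : ℕ) : ℤ)) → 1 ≤ n →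
      ∀ (m : ℕ), Valued.v (((finCharpolyTwo L v γH).eval (finGammaTwo L v γH)) w) =
          Valued.v ((toPlace v w (HeckeCharacter.uniformizer ↥(maximalRealSubfield L) v : v.adicCompletion ↥(maximalRealSubfield L))) ^ m) →
        ∀ β : (v.adicCompletion ↥(maximalRealSubfield L))ˣ,
          toPlace v w (β : v.adicCompletion ↥(maximalRealSubfield L)) =
            -(((finCharpolyTwo L v γH).eval (finGammaTwo L v γH)) w *
                (finGammaTwo L v γH w ^ 2 +
                  ((γH.1.val.val : Matrix (Fin 2) (Fin 2) (LocalRing L v)).map (Pi.evalRingHom (fun w' : PlacesOver L v => w'.1.adicCompletion L) w)).det)) /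
              (2 * finGammaTwo L v γH w ^ 2 *
                ((γH.1.val.val : Matrix (Fin 2) (Fin 2) (LocalRing L v)).map (Pi.evalRingHom (fun w' : PlacesOver L v => w'.1.adicCompletion L) w)).det) →
      ∀ tp tm : ((cmDatum L 3 H').Local v), IsLocalNormPair L H' v γH tp → IsLocalNormPair L H' v γH tm → finKappaAt L v H' γH tp = 1 → finKappaAt L v H' γH tm = -1 →
        (∀ a b, Valued.v (((toPlace v w (HeckeCharacter.uniformizer ↥(maximalRealSubfield L) v : v.adicCompletion ↥(maximalRealSubfield L))) ^ 1)⁻¹ * ((((tp).val : GL (Fin 3) (UnitaryGroup.LocalRing L v)).val.map (Pi.evalRingHom (fun w' : PlacesOver L v => w'.1.adicCompletion L) w)) a b - (1 : Matrix (Fin 3) (Fin 3) (w.1.adicCompletion L)) a b)) ≤ 1) → (∀ a b, Valued.v (((toPlace v w (HeckeCharacter.uniformizer ↥(maximalRealSubfield L) v : v.adicCompletion ↥(maximalRealSubfield L))) ^ 1)⁻¹ * ((((tm).val : GL (Fin 3) (UnitaryGroup.LocalRing L v)).val.map (Pi.evalRingHom (fun w' : PlacesOver L v => w'.1.adicCompletion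 L) w)) a b - (1 : Matrix (Fin 3) (Fin 3) (w.1.adicCompletion L)) a b)) ≤ 1) →
        ((hilbertSymbol (v.adicCompletion ↥(maximalRealSubfield L)) (β : v.adicCompletion ↥(maximalRealSubfield L))
        (algebraMap ↥(maximalRealSubfield L) _ ((cmQuadraticGenerator L : 𝓞 ↥(maximalRealSubfield L)) : ↥(maximalRealSubfield L))) : ℂ) * ((Ideal.absNorm v.asIdeal : ℂ) ^ m)⁻¹) * (({q : (((cmDatum L 3 H').Local v) ⧸ cmLocalIntegralLevel L 3 H' v) | q ∈ MulAction.fixedBy (((cmDatum L 3 H').Local v) ⧸ cmLocalIntegralLevel L 3 H' v) tp ∧ (redMat (((((q.out⁻¹ * tp * q.out)).val : GL (Fin 3) (UnitaryGroup.LocalRing L v)).val.map (Pi.evalRingHom (fun w' : PlacesOver L v => w'.1.adicCompletion L) w))) - 1).rank = 2}.ncard : ℂ) - ({q : (((cmDatum L 3 H').Local v) ⧸ cmLocalIntegralLevel L 3 H' v) | q ∈ MulAction.fixedBy (((cmDatum L 3 H').Local v) ⧸ cmLocalIntegralLevel L 3 H' v) tm ∧ (redMat (((((q.out⁻¹ *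 tm * q.out)).val : GL (Fin 3) (UnitaryGroup.LocalRing L v)).val.map (Pi.evalRingHom (fun w' : PlacesOver L v => w'.1.adicCompletion L) w))) - 1).rank = 2}.ncard : ℂ)) = (hilbertSymbol (v.adicCompletion ↥(maximalRealSubfield L)) yl
        (algebraMap ↥(maximalRealSubfield L) _ ((cmQuadraticGenerator L : 𝓞 ↥(maximalRealSubfield L)) : ↥(maximalRealSubfield L))) : ℂ) * (2 * (Ideal.absNorm v.asIdeal : ℂ) ^ n) ∧
        ((hilbertSymbol (v.adicCompletion ↥(maximalRealSubfield L)) (β : v.adicCompletion ↥(maximalRealSubfield L))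
        (algebraMap ↥(maximalRealSubfield L) _ ((cmQuadraticGenerator L : 𝓞 ↥(maximalRealSubfield L)) : ↥(maximalRealSubfield L))) : ℂ) * ((Ideal.absNorm v.asIdeal : ℂ) ^ m)⁻¹) * (({q : (((cmDatum L 3 H').Local v) ⧸ cmLocalIntegralLevel L 3 H' v) | q ∈ MulAction.fixedBy (((cmDatum L 3 H').Local v) ⧸ cmLocalIntegralLevel L 3 H' v) tp ∧ (redMat (((((q.out⁻¹ * tp * q.out)).val : GL (Fin 3) (UnitaryGroup.LocalRing L v)).val.map (Pi.evalRingHom (fun w' : PlacesOver L v => w'.1.adicCompletion L) w))) - 1).rank = 0 ∧ (redMat (ϖ⁻¹ • (((((q.out⁻¹ * tp * q.out)).val : GL (Fin 3) (UnitaryGroup.LocalRing L v)).val.map (Pi.evalRingHom (fun w' : PlacesOver L v => w'.1.adicCompletion L) w)) - 1))).rank = 2}.ncard : ℂ) - ({q : (((cmDatum L 3 H').Local v) ⧸ cmLocalIntegralLevel L 3 H' v) | q ∈ MulAction.fixedBy (((cmDatum L 3 H').Local v) ⧸ cmLocalIntegralLevel L 3 H' v) tm ∧ (redMat (((((q.out⁻¹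 * tm * q.out)).val : GL (Fin 3) (UnitaryGroup.LocalRing L v)).val.map (Pi.evalRingHom (fun w' : PlacesOver L v => w'.1.adicCompletion L) w))) - 1).rank = 0 ∧ (redMat (ϖ⁻¹ • (((((q.out⁻¹ * tm * q.out)).val : GL (Fin 3) (UnitaryGroup.LocalRing L v)).val.map (Pi.evalRingHom (fun w' : PlacesOver L v => w'.1.adicCompletion L) w)) - 1))).rank = 2}.ncard : ℂ)) = (hilbertSymbol (v.adicCompletion ↥(maximalRealSubfield L)) yl
        (algebraMap ↥(maximalRealSubfield L) _ ((cmQuadraticGenerator L : 𝓞 ↥(maximalRealSubfield L)) : ↥(maximalRealSubfield L))) : ℂ) * (2 * (Ideal.absNorm v.asIdeal : ℂ) ^ n / (Ideal.absNorm v.asIdeal : ℂ)) ∧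
        ((hilbertSymbol (v.adicCompletion ↥(maximalRealSubfield L)) (β : v.adicCompletion ↥(maximalRealSubfield L))
        (algebraMap ↥(maximalRealSubfield L) _ ((cmQuadraticGenerator L : 𝓞 ↥(maximalRealSubfield L)) : ↥(maximalRealSubfield L))) : ℂ) * ((Ideal.absNorm v.asIdeal : ℂ) ^ m)⁻¹) * (({q : (((cmDatum L 3 H').Local v) ⧸ cmLocalIntegralLevel L 3 H' v) | q ∈ MulAction.fixedBy (((cmDatum L 3 H').Local v) ⧸ cmLocalIntegralLevel L 3 H' v) tp ∧ (redMat (((((q.out⁻¹ * tp * q.out)).val : GL (Fin 3) (UnitaryGroup.LocalRing L v)).val.map (Pi.evalRingHom (fun w' : PlacesOver L v => w'.1.adicCompletion L) w))) - 1).rank = 0 ∧ (redMat (ϖ⁻¹ • (((((q.out⁻¹ * tp * q.out)).val : GL (Fin 3) (UnitaryGroup.LocalRing L v)).val.map (Pi.evalRingHom (fun w' : PlacesOver L v => w'.1.adicCompletion L) w)) - 1))).rank = 1 ∧ ∃ (z : Fin 3 → 𝓀[(w.1.adicCompletion L)]) (a : 𝓀[(w.1.adicCompletion L)]), a ≠ 0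 ∧ z ⬝ᵥ ((redMat (placeForm H' w.1) * redMat (ϖ⁻¹ • (((((q.out⁻¹ * tp * q.out)).val : GL (Fin 3) (UnitaryGroup.LocalRing L v)).val.map (Pi.evalRingHom (fun w' : PlacesOver L v => w'.1.adicCompletion L) w)) - 1))) *ᵥ z) = a ^ 2}.ncard : ℂ) - ({q : (((cmDatum L 3 H').Local v) ⧸ cmLocalIntegralLevel L 3 H' v) | q ∈ MulAction.fixedBy (((cmDatum L 3 H').Local v) ⧸ cmLocalIntegralLevel L 3 H' v) tm ∧ (redMat (((((q.out⁻¹ * tm * q.out)).val : GL (Fin 3) (UnitaryGroup.LocalRing L v)).val.map (Pi.evalRingHom (fun w' : PlacesOver L v => w'.1.adicCompletion L) w))) - 1).rank = 0 ∧ (redMat (ϖ⁻¹ • (((((q.out⁻¹ * tm * q.out)).val : GL (Fin 3) (UnitaryGroup.LocalRing L v)).val.map (Pi.evalRingHom (fun w' : PlacesOver L v => w'.1.adicCompletion L) w)) - 1))).rank = 1 ∧ ∃ (z : Fin 3 → 𝓀[(w.1.adicCompletion L)]) (a : 𝓀[(w.1.adicCompletion L)]), a ≠ 0 ∧ z ⬝ᵥ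 ((redMat (placeForm H' w.1) * redMat (ϖ⁻¹ • (((((q.out⁻¹ * tm * q.out)).val : GL (Fin 3) (UnitaryGroup.LocalRing L v)).val.map (Pi.evalRingHom (fun w' : PlacesOver L v => w'.1.adicCompletion L) w)) - 1))) *ᵥ z) = a ^ 2}.ncard : ℂ)) = (hilbertSymbol (v.adicCompletion ↥(maximalRealSubfield L)) yl
        (algebraMap ↥(maximalRealSubfield L) _ ((cmQuadraticGenerator L : 𝓞 ↥(maximalRealSubfield L)) : ↥(maximalRealSubfield L))) : ℂ) * (((Ideal.absNorm v.asIdeal : ℂ) ^ n - (Ideal.absNorm v.asIdeal : ℂ) - 1) / (Ideal.absNorm v.asIdeal : ℂ) ^ 2) ∧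
        ((hilbertSymbol (v.adicCompletion ↥(maximalRealSubfield L)) (β : v.adicCompletion ↥(maximalRealSubfield L))
        (algebraMap ↥(maximalRealSubfield L) _ ((cmQuadraticGenerator L : 𝓞 ↥(maximalRealSubfield L)) : ↥(maximalRealSubfield L))) : ℂ) * ((Ideal.absNorm v.asIdeal : ℂ) ^ m)⁻¹) * (({q : (((cmDatum L 3 H').Local v) ⧸ cmLocalIntegralLevel L 3 H' v) | q ∈ MulAction.fixedBy (((cmDatum L 3 H').Local v) ⧸ cmLocalIntegralLevel L 3 H' v) tp ∧ (redMat (((((q.out⁻¹ * tp * q.out)).val : GL (Fin 3) (UnitaryGroup.LocalRing L v)).val.map (Pi.evalRingHom (fun w' : PlacesOver L v => w'.1.adicCompletion L) w))) - 1).rank = 0 ∧ (redMat (ϖ⁻¹ • (((((q.out⁻¹ * tp * q.out)).val : GL (Fin 3) (UnitaryGroup.LocalRing L v)).val.map (Pi.evalRingHom (fun w' : PlacesOver L v => w'.1.adicCompletion L) w)) - 1))).rank = 1 ∧ ¬ ∃ (z : Fin 3 → 𝓀[(w.1.adicCompletion L)]) (a : 𝓀[(w.1.adicCompletion L)]), a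 ≠ 0 ∧ z ⬝ᵥ ((redMat (placeForm H' w.1) * redMat (ϖ⁻¹ • (((((q.out⁻¹ * tp * q.out)).val : GL (Fin 3) (UnitaryGroup.LocalRing L v)).val.map (Pi.evalRingHom (fun w' : PlacesOver L v => w'.1.adicCompletion L) w)) - 1))) *ᵥ z) = a ^ 2}.ncard : ℂ) - ({q : (((cmDatum L 3 H').Local v) ⧸ cmLocalIntegralLevel L 3 H' v) | q ∈ MulAction.fixedBy (((cmDatum L 3 H').Local v) ⧸ cmLocalIntegralLevel L 3 H' v) tm ∧ (redMat (((((q.out⁻¹ * tm * q.out)).val : GL (Fin 3) (UnitaryGroup.LocalRing L v)).val.map (Pi.evalRingHom (fun w' : PlacesOver L v => w'.1.adicCompletion L) w))) - 1).rank = 0 ∧ (redMat (ϖ⁻¹ • (((((q.out⁻¹ * tm * q.out)).val : GL (Fin 3) (UnitaryGroup.LocalRing L v)).val.map (Pi.evalRingHom (fun w' : PlacesOver L v => w'.1.adicCompletion L) w)) - 1))).rank = 1 ∧ ¬ ∃ (z : Fin 3 → 𝓀[(w.1.adicCompletion L)]) (a : 𝓀[(w.1.adicCompletion L)]), a ≠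 0 ∧ z ⬝ᵥ ((redMat (placeForm H' w.1) * redMat (ϖ⁻¹ • (((((q.out⁻¹ * tm * q.out)).val : GL (Fin 3) (UnitaryGroup.LocalRing L v)).val.map (Pi.evalRingHom (fun w' : PlacesOver L v => w'.1.adicCompletion L) w)) - 1))) *ᵥ z) = a ^ 2}.ncard : ℂ)) = (hilbertSymbol (v.adicCompletion ↥(maximalRealSubfield L)) yl
        (algebraMap ↥(maximalRealSubfield L) _ ((cmQuadraticGenerator L : 𝓞 ↥(maximalRealSubfield L)) : ↥(maximalRealSubfield L))) : ℂ) * (((Ideal.absNorm v.asIdeal : ℂ) ^ n - (Ideal.absNorm v.asIdeal : ℂ) - 1) / (Ideal.absNorm v.asIdeal : ℂ) ^ 2) ∧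
        ((hilbertSymbol (v.adicCompletion ↥(maximalRealSubfield L)) (β : v.adicCompletion ↥(maximalRealSubfield L))
        (algebraMap ↥(maximalRealSubfield L) _ ((cmQuadraticGenerator L : 𝓞 ↥(maximalRealSubfield L)) : ↥(maximalRealSubfield L))) : ℂ) * ((Ideal.absNorm v.asIdeal : ℂ) ^ m)⁻¹) * (({q : (((cmDatum L 3 H').Local v) ⧸ cmLocalIntegralLevel L 3 H' v) | q ∈ MulAction.fixedBy (((cmDatum L 3 H').Local v) ⧸ cmLocalIntegralLevel L 3 H' v) tp ∧ (redMat (((((q.out⁻¹ * tp * q.out)).val : GL (Fin 3) (UnitaryGroup.LocalRing L v)).val.map (Pi.evalRingHom (fun w' : PlacesOver L v => w'.1.adicCompletion L) w))) - 1).rank = 0 ∧ (redMat (ϖ⁻¹ • (((((q.out⁻¹ * tp * q.out)).val : GL (Fin 3) (UnitaryGroup.LocalRing L v)).val.map (Pi.evalRingHom (fun w' : PlacesOver L v => w'.1.adicCompletion L) w)) - 1))).rank = 0}.ncard : ℂ) - ({q : (((cmDatum L 3 H').Local v) ⧸ cmLocalIntegralLevel L 3 H' v) | q ∈ MulAction.fixedBy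 (((cmDatum L 3 H').Local v) ⧸ cmLocalIntegralLevel L 3 H' v) tm ∧ (redMat (((((q.out⁻¹ * tm * q.out)).val : GL (Fin 3) (UnitaryGroup.LocalRing L v)).val.map (Pi.evalRingHom (fun w' : PlacesOver L v => w'.1.adicCompletion L) w))) - 1).rank = 0 ∧ (redMat (ϖ⁻¹ • (((((q.out⁻¹ * tm * q.out)).val : GL (Fin 3) (UnitaryGroup.LocalRing L v)).val.map (Pi.evalRingHom (fun w' : PlacesOver L v => w'.1.adicCompletion L) w)) - 1))).rank = 0}.ncard : ℂ)) = (hilbertSymbol (v.adicCompletion ↥(maximalRealSubfield L)) yl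
        (algebraMap ↥(maximalRealSubfield L) _ ((cmQuadraticGenerator L : 𝓞 ↥(maximalRealSubfield L)) : ↥(maximalRealSubfield L))) : ℂ) * (2 * ((Ideal.absNorm v.asIdeal : ℂ) ^ n - 1) / (((Ideal.absNorm v.asIdeal : ℂ) - 1) * (Ideal.absNorm v.asIdeal : ℂ) ^ 2)) :=
  typeTwo_signedCounts_odd_ram_of_latticeCounts L H' hH' w hw he hH'w hH'i h2 ϖ hϖ hσϖ A hA hframe
    (stub_T2G_zero_odd_lat_of_blockLaw L H' hH' w hw he hH'w hH'i h2 ϖ hϖ hσϖ A hA hframe (TypeTwoBlockLaw.typeTwo_blockLaw_zero_odd_ram L H' hH' w hw he hH'w hH'i h2 ϖ hϖ hσϖ A hA hframe))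
    (stub_T2G_pm_odd_lat_of_blockLaw L H' hH' w hw he hH'w hH'i h2 ϖ hϖ hσϖ A hA hframe (TypeTwoBlockLaw.typeTwo_blockLaw_pm_odd_ram L H' hH' w hw he hH'w hH'i h2 ϖ hϖ hσϖ A hA hframe)) yl hyl

end Literature.NumberTheory.Rogawski1990

end
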